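import Mathlib.Probability.Distributions.SetBernoulli
import Mathlib.Combinatorics.SimpleGraph.Connectivity.Connected
import Mathlib.Analysis.SpecialFunctions.Exp
import Mathlib.Topology.UnitInterval
import Mathlib.Order.Interval.Set.ProjIcc
import Mathlib.Order.UpperLower.Basic

/-!
# Bernoulli bond percolation on ℤ^d — the statement «θ_d(p_c(d)) = 0 for every d ≥ 2»

Faithful Lean 4 / Mathlib statement of the brief of cell pub-perc-repro0 (README §1), following the
conventions of route/ROUTE-v1.md §0 verbatim:

* vertices `Fin d → ℤ`; bonds `𝔼^d` = the edge set of the nearest-neighbour graph (`‖x − y‖₁ = 1`);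
* a configuration is the SET of open bonds, `Config d = Set (Sym2 (Fin d → ℤ))`, with the product
  σ-algebra (Mathlib's `Set.instMeasurableSpace`, i.e. the coordinate maps `ω ↦ (e ∈ ω)` are measurable);
* `P d p = setBernoulli (bonds d) p` is Mathlib's product of Bernoulli(p) laws over the bonds
  (`Mathlib.Probability.Distributions.SetBernoulli`, built on `Measure.infinitePi`): every bond of `𝔼^d`
  is open independently with probability `p`; non-bonds are a.s. closed;
* `x ↔ y` (`Conn`) = reachability in the graph of open bonds; `C(x)` (`cluster`); `x ↔ ∞` (`ConnInf`);
* `θ_d(p) = P_p(0 ↔ ∞)` (`thetaI` on the unit interval, `theta` on `ℝ` by clamping to `[0,1]`);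
* `p_c(d) = inf { p ∈ [0,1] : θ_d(p) > 0 }` (`pc`, ROUTE-v1 §0, inf form);
* `T d : θ_d(p_c(d)) = 0`, `Target : ∀ d ≥ 2, T d` — the brief.

Every named intermediate statement of ROUTE-v1 §2 that is expressible with these objects is stated
below as a `def … : Prop` (no proof claimed), and the regime split R0 is proved (`R0_regime_split`).

Namespace: `Summit.Ventures.PercRepro0.Defs` (this file is `PercRepro0/Defs.lean`, the cell's single
definitions file per the lead's ruling of 2026-08-25T23:00:52Z; the sub-namespace keeps its names
disjoint from every other module of the directory).

Design notes (junk values, documented):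
* `theta d p` for `p ∉ [0,1]` is `θ_d` of the clamped value; only `[0,1]` is ever used.
* `pc d` is a real `sInf`; the defining set is non-empty (it contains `1`, since `θ_d(1) = 1`) and bounded
  below by `0`, so no junk is hit; the proof of `θ_d(1) = 1` is a lemma (L4-type), not part of the definition.
* `boundary d n` is `Λ_n \ Λ_{n−1}` for `n ≥ 1` (for `n = 0` it is `{0}`, never used).
* Events are `Set (Config d)`; measures are applied as outer measures, so no measurability proof is needed
  to STATE anything; measurability of the events used is an L-lemma.

Nothing here imports anything outside Mathlib.
-/

namespace Summit.Ventures.PercRepro0.Defs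

open MeasureTheory ProbabilityTheory unitInterval
open scoped ENNReal Topology

/-! ## The lattice -/

/-- The vertex set of `ℤ^d`. -/
abbrev Vertex (d : ℕ) : Type := Fin d → ℤ

/-- The nearest-neighbour lattice `𝕃^d`: `x ~ y` iff `‖x − y‖₁ = 1`. -/
def lattice (d : ℕ) : SimpleGraph (Vertex d) where
  Adj x y := (∑ i, |x i - y i|) = 1
  symm := ⟨fun x y h => (Finset.sum_congr rfl fun i _ => abs_sub_comm (y i) (x i)).trans h⟩
  loopless := ⟨fun _ h => by simp at h⟩

/-- The bond set `𝔼^d` (unordered nearest-neighbour pairs). -/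
def bonds (d : ℕ) : Set (Sym2 (Vertex d)) := (lattice d).edgeSet

/-- The box `Λ_n = [−n, n]^d ∩ ℤ^d`. -/
def box (d : ℕ) (n : ℕ) : Set (Vertex d) := {x | ∀ i, |x i| ≤ n}

/-- The boundary `∂Λ_n = Λ_n \ Λ_{n−1}` (`n ≥ 1`): points of the box with some coordinate of modulus `n`. -/
def boundary (d : ℕ) (n : ℕ) : Set (Vertex d) := {x | (∀ i, |x i| ≤ n) ∧ ∃ i, |x i| = n}

/-! ## Configurations and the product measure -/

/-- A configuration: the set of OPEN bonds (`e ∈ ω` ⇔ `ω(e) = 1`). -/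
abbrev Config (d : ℕ) : Type := Set (Sym2 (Vertex d))

/-- `P_p`: the product of Bernoulli(`p`) laws over the bonds of `𝕃^d` (Mathlib's `setBernoulli`). -/
noncomputable def P (d : ℕ) (p : I) : Measure (Config d) := setBernoulli (bonds d) p

/-- `P_p` is a probability measure (inherited from Mathlib's `setBernoulli`). -/
instance instIsProbabilityMeasureP (d : ℕ) (p : I) : IsProbabilityMeasure (P d p) :=
  inferInstanceAs (IsProbabilityMeasure (setBernoulli (bonds d) p))

/-- The graph of open bonds of a configuration (only genuine bonds count). -/
def openGraph (d : ℕ) (ω : Config d) : SimpleGraph (Vertex d) :=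
  SimpleGraph.fromEdgeSet (ω ∩ bonds d)

/-- `x ↔ y` in `ω`: some open path joins `x` to `y` (`x ↔ x` always). -/
def Conn (d : ℕ) (ω : Config d) (x y : Vertex d) : Prop := (openGraph d ω).Reachable x y

/-- The open cluster `C(x) = { y : x ↔ y }`. -/
def cluster (d : ℕ) (ω : Config d) (x : Vertex d) : Set (Vertex d) := {y | Conn d ω x y}

/-- `x ↔ ∞`: the open cluster of `x` is infinite. -/
def ConnInf (d : ℕ) (ω : Config d) (x : Vertex d) : Prop := (cluster d ω x).Infinite

/-- The event `{0 ↔ ∞}`. -/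
def percolates (d : ℕ) : Set (Config d) := {ω | ConnInf d ω 0}

/-- The event `{0 ↔ ∂Λ_n}`. -/
def toBoundary (d : ℕ) (n : ℕ) : Set (Config d) := {ω | ∃ y ∈ boundary d n, Conn d ω 0 y}

/-- The event `{∃ an infinite open cluster}`. -/
def existsInfCluster (d : ℕ) : Set (Config d) := {ω | ∃ x, ConnInf d ω x}

/-- The event `{at most one infinite open cluster}`. -/
def atMostOneInfCluster (d : ℕ) : Set (Config d) :=
  {ω | ∀ x y, ConnInf d ω x → ConnInf d ω y → Conn d ω x y}

/-! ## θ, p_c and the target -/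

/-- `θ_d(p) = P_p(0 ↔ ∞)` for `p` in the unit interval. -/
noncomputable def thetaI (d : ℕ) (p : I) : ℝ := (P d p (percolates d)).toReal

/-- Clamp a real number to `[0,1]`. -/
noncomputable def clamp (p : ℝ) : I := Set.projIcc (0 : ℝ) 1 zero_le_one p

/-- `θ_d` as a function on `ℝ` (clamped; only `[0,1]` is used). -/
noncomputable def theta (d : ℕ) (p : ℝ) : ℝ := thetaI d (clamp p)

/-- The set `{ p ∈ [0,1] : θ_d(p) > 0 }` whose infimum is `p_c(d)`. -/
def pcSet (d : ℕ) : Set ℝ := {p : ℝ | p ∈ Set.Icc (0 : ℝ) 1 ∧ 0 < theta d p}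

/-- `p_c(d) = inf { p ∈ [0,1] : θ_d(p) > 0 }` (ROUTE-v1 §0). -/
noncomputable def pc (d : ℕ) : ℝ := sInf (pcSet d)

/-- The set `{ p ∈ [0,1] : θ_d(p) = 0 }` whose supremum is the «sup form» of the critical probability
(MEMO-p5-v1 §1); its equality with `pc d` under monotonicity is a lemma, not a definition. -/
def zeroSet (d : ℕ) : Set ℝ := {p : ℝ | p ∈ Set.Icc (0 : ℝ) 1 ∧ theta d p = 0}

/-- `T(d)`: `θ_d(p_c(d)) = 0`. -/
def T (d : ℕ) : Prop := theta d (pc d) = 0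

/-- THE TARGET (README §1): for every `d ≥ 2`, `θ_d(p_c(d)) = 0`. -/
def Target : Prop := ∀ d : ℕ, 2 ≤ d → T d

/-! ## Two-point function and diagrams -/

/-- `τ_p(x,y) = P_p(x ↔ y)`. -/
noncomputable def tau (d : ℕ) (p : I) (x y : Vertex d) : ℝ := (P d p {ω | Conn d ω x y}).toReal

/-- The triangle condition at `p`: `∇_p = Σ_{x,y} τ_p(0,x) τ_p(x,y) τ_p(y,0) < ∞`
(as a `Summable` family of non-negative reals). -/
def TriangleCondition (d : ℕ) (p : I) : Prop :=
  Summable fun xy : Vertex d × Vertex d => tau d p 0 xy.1 * tau d p xy.1 xy.2 * tau d p xy.2 0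

/-- The bubble condition at `p`: `Σ_x τ_p(0,x)² < ∞`. -/
def BubbleCondition (d : ℕ) (p : I) : Prop :=
  Summable fun x : Vertex d => tau d p 0 x * tau d p 0 x

/-! ## Named statements of ROUTE-v1 §2 (statements only; proofs are separate files) -/

/-- L1 · MONOTONE: `p ≤ p′ ⇒ P_p(A) ≤ P_{p′}(A)` for every increasing (measurable) event `A`
(in particular for `{0 ↔ ∞}`, so `θ_d` is non-decreasing). -/
def L1_Monotone (d : ℕ) : Prop :=
  ∀ p q : I, p ≤ q → ∀ A : Set (Config d), IsUpperSet A → MeasurableSet A → P d p A ≤ P d q A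

/-- L2 · RIGHT-CONT: `P_p(0 ↔ ∂Λ_n) → θ_d(p)` as `n → ∞`, and `θ_d` is right-continuous on `[0,1)`. -/
def L2_RightCont (d : ℕ) : Prop :=
  (∀ p : I, Filter.Tendsto (fun n : ℕ => (P d p (toBoundary d n)).toReal) Filter.atTop
      (𝓝 (thetaI d p))) ∧
  ∀ p : ℝ, 0 ≤ p → p < 1 → ContinuousWithinAt (theta d) (Set.Ioi p) p

/-- L4 · NONTRIVIAL (`d ≥ 2`): `1/(2d−1) ≤ p_c(d) < 1` and `p_c(d+1) ≤ p_c(d)`. -/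
def L4_Nontrivial (d : ℕ) : Prop :=
  (1 / (2 * (d : ℝ) - 1) ≤ pc d ∧ pc d < 1) ∧ pc (d + 1) ≤ pc d

/-- L5 · ZERO-ONE: `P_p(∃ infinite open cluster) ∈ {0,1}`, and it is `1` iff `θ_d(p) > 0`. -/
def L5_ZeroOne (d : ℕ) : Prop :=
  ∀ p : I, (P d p (existsInfCluster d) = 0 ∨ P d p (existsInfCluster d) = 1) ∧
    (P d p (existsInfCluster d) = 1 ↔ 0 < thetaI d p)

/-- P7 · FKG/HARRIS: increasing events are positively correlated. -/
def P7_FKG (d : ℕ) : Prop :=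
  ∀ (p : I) (A B : Set (Config d)), IsUpperSet A → IsUpperSet B →
    MeasurableSet A → MeasurableSet B → P d p A * P d p B ≤ P d p (A ∩ B)

/-- P3 · UNIQUE: for every `p`, a.s. at most one infinite open cluster. -/
def P3_Unique (d : ℕ) : Prop := ∀ p : I, P d p (atMostOneInfCluster d) = 1

/-- P5 · SHARPNESS: below `p_c(d)` the box-crossing probabilities decay exponentially. -/
def P5_Sharpness (d : ℕ) : Prop :=
  ∀ p : I, (p : ℝ) < pc d → ∃ c : ℝ, 0 < c ∧ ∀ n : ℕ, 1 ≤ n →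
    (P d p (toBoundary d n)).toReal ≤ Real.exp (-(c * n))

/-- P1 · HARRIS: `θ_2(1/2) = 0`. -/
def P1_Harris : Prop := theta 2 (1 / 2) = 0

/-- T2 · PLANAR-ASSEMBLY: `θ_2(p_c(2)) = 0` and `p_c(2) = 1/2`. -/
def T2_Planar : Prop := T 2 ∧ pc 2 = 1 / 2

/-- H1 · TRIANGLE-11: the triangle condition holds at `p_c(d)` for every `d ≥ 11`. -/
def H1_Triangle11 : Prop := ∀ d : ℕ, 11 ≤ d → TriangleCondition d (clamp (pc d))

/-- H2 · TRIANGLE ⇒ BETA (β-form): the triangle condition at `p_c(d)` gives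
`θ_d(p) ≤ C (p − p_c(d))` just above `p_c(d)`. -/
def H2_TriangleImpliesBeta (d : ℕ) : Prop :=
  TriangleCondition d (clamp (pc d)) →
    ∃ C ε : ℝ, 0 < ε ∧ ∀ p : ℝ, pc d < p → p < pc d + ε → theta d p ≤ C * (p - pc d)

/-- T_HD · HIGH-D: `θ_d(p_c(d)) = 0` for every `d ≥ 11`. -/
def THD : Prop := ∀ d : ℕ, 11 ≤ d → T d

/-- T_MID · MID-DIM: `θ_d(p_c(d)) = 0` for every `3 ≤ d ≤ 10` (OPEN-RESIDUAL at ROUTE-v1). -/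
def TMID : Prop := ∀ d : ℕ, 3 ≤ d → d ≤ 10 → T d

/-- R_MID-1 · EQUIVALENT-FORMS: `T(d) ⟺ lim_n P_{p_c}(0 ↔ ∂Λ_n) = 0 ⟺ P_{p_c}(∃ infinite cluster) = 0`. -/
def RMID1_Equivalents (d : ℕ) : Prop :=
  (T d ↔ Filter.Tendsto (fun n : ℕ => (P d (clamp (pc d)) (toBoundary d n)).toReal) Filter.atTop
      (𝓝 0)) ∧
  (T d ↔ P d (clamp (pc d)) (existsInfCluster d) = 0)

/-! ## R0 · REGIME-SPLIT (PROVED-HERE) -/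

/-- R0: the three regimes `d = 2`, `3 ≤ d ≤ 10`, `d ≥ 11` exhaust `d ≥ 2`, so `T2 ∧ T_HD ∧ T_MID ⇒ T`. -/
theorem R0_regime_split (h2 : T2_Planar) (hHD : THD) (hMID : TMID) : Target := by
  intro d hd
  rcases Nat.lt_or_ge d 3 with h3 | h3
  · have : d = 2 := by omega
    subst this
    exact h2.1
  · rcases Nat.lt_or_ge d 11 with h11 | h11
    · exact hMID d h3 (by omega)
    · exact hHD d h11

/-- R0, conjunctive form. -/
theorem R0_regime_split' (h : T2_Planar ∧ THD ∧ TMID) : Target :=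
  R0_regime_split h.1 h.2.1 h.2.2

/-! ## Trivial bounds (PROVED-HERE) -/

/-- `0 ≤ θ_d(p)`. -/
theorem thetaI_nonneg (d : ℕ) (p : I) : 0 ≤ thetaI d p := ENNReal.toReal_nonneg

/-- `θ_d(p) ≤ 1`. -/
theorem thetaI_le_one (d : ℕ) (p : I) : thetaI d p ≤ 1 := by
  unfold thetaI
  exact ENNReal.toReal_le_of_le_ofReal zero_le_one (by simpa using (prob_le_one : P d p (percolates d) ≤ 1))

/-- `0 ≤ θ_d(p)` on `ℝ`. -/
theorem theta_nonneg (d : ℕ) (p : ℝ) : 0 ≤ theta d p := thetaI_nonneg d _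

/-- `θ_d(p) ≤ 1` on `ℝ`. -/
theorem theta_le_one (d : ℕ) (p : ℝ) : theta d p ≤ 1 := thetaI_le_one d _

/-- `T(d)` unfolds to `θ_d(p_c(d)) = 0`. -/
theorem T_iff (d : ℕ) : T d ↔ theta d (pc d) = 0 := Iff.rfl

end Summit.Ventures.PercRepro0.Defs
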